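import Literature.Analysis.FluidPDE.TorusClassicalNSSobolevFourWindow
import Literature.Analysis.FunctionSpaces.TorusConvectionGradLaplacianNormSq
import HarnessLib

/-!
# `H⁴` smoothing of classical Navier–Stokes solutions on `T³` under `H³` and `W^{1,∞}` bounds

Analysis/FluidPDE proof file (theorems only; no definitions, no named facts), sequel of
`TorusClassicalNSH2Smoothing.lean` / `TorusClassicalNSH3Smoothing.lean` (the pointwise-in-time `H²` and `H³`
smoothing estimates), `TorusClassicalNSL2H4Smoothing.lean` / `TorusClassicalNSSobolevFourWindow.lean` (the
time-integrated bound `∫ₐ^{a+τ} ‖Δ²u‖₂² ≤ C₄` and the Chebyshev time `t₁ ∈ [a, a + τ]` with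
`‖Δ²u(t₁)‖₂² ≤ C₄/τ`), `TorusClassicalHnBalance.lean` (the even-order balances `d/dt ½‖Δⁿu‖₂²`) and
`FunctionSpaces/TorusConvectionGradLaplacianNormSq.lean`
(`‖∇Δ((u·∇)u)‖₂² ≤ C ((M² + ‖Δu‖₂²) ‖Δ²u‖₂² + (Λ² + ‖Δu‖₂²) ‖∇Δu‖₂²)` on `T³` when `‖u‖ ≤ M`, `‖∂ₖu‖ ≤ Λ`).
For a classical solution `(u, p)` of the forced incompressible Navier–Stokes system on `T^d × [a, a + τ]`,
`card d = 3`, `ν > 0`, with zero-mean velocity slices, the main theorem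
`Torus.IsClassicalNSSolutionOn.integral_norm_laplacian_laplacian_sq_le_of_le` is the QUANTITATIVE PARABOLIC
SMOOTHING ESTIMATE in `H⁴`:

`sup_{[a,a+τ]} ‖∇u‖₂² ≤ E₁`, `sup ‖Δu‖₂² ≤ Y₁`, `sup ‖∇Δu‖₂² ≤ Z₁`, `sup ‖Δf‖₂² ≤ G₂`, `sup ‖∇Δf‖₂² ≤ G₃`,
`sup ‖u‖_∞ ≤ M`, `sup ‖∂ₖu‖_∞ ≤ Λ₁`  ⟹  `‖Δ²u(a + τ)‖₂² ≤ C(d, ν, E₁, Y₁, Z₁, G₂, G₃, M, Λ₁, τ)`,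

with a constant independent of `a`, of the solution and of `‖Δ²u(a)‖₂` — the `k = 4` step of the regularity
ladder of strong solutions (Robinson–Rodrigo–Sadowski 2016, Thm 7.1: the differential inequality (7.3)
`d/dt ‖u‖²_{H^k} ≤ c ‖u‖²_{H^{k-1}}-controlled · ‖u‖²_{H^k}` is LINEAR in the top order once the lower norms are
bounded, with `∫ ‖u‖²_{H^k} < ∞` from the previous level; Thm 7.5: start from a time at which `u ∈ H^k`;
Constantin–Foias 1988, Thm 10.6, the periodic case). On `T³` the `W^{1,∞}` levels `M, Λ₁` are themselves
consequences of the `H²`/`H³` bounds (`TorusClassicalNSH3Smoothing`), so chained after the `H²`, `H³` steps this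
makes compact invariant sets of strong solutions bounded in `H⁴`.

* `Torus.IsClassicalNSSolutionOn.hasDerivWithinAt_half_integral_norm_laplacian_laplacian_sq` — the `H⁴` balance
  `d/dt ½‖Δ²u‖₂² = −ν‖∇Δ²u‖₂² − ∫ ⟪(u·∇)u − f, Δ⁴u⟫` (the case `n = 2` of the even-order balances, spelled
  without iterates);
* `Torus.IsClassicalNSSolutionOn.laplacian_laplacian_flux_le` — its flux bound in every dimension,
  `−ν‖∇Δ²u‖₂² − ∫ ⟪(u·∇)u − f, Δ⁴u⟫ ≤ −(ν/2)‖∇Δ²u‖₂² + ν⁻¹ (‖∇Δf‖₂² + ‖∇Δ((u·∇)u)‖₂²)` (move one Laplacian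
  across, then Young for `∫ ⟪Δg, Δ(Δ²u)⟫` against `‖∇Δg‖₂ ‖∇Δ²u‖₂`);
* `Torus.IsClassicalNSSolutionOn.integral_norm_laplacian_laplacian_sq_le_of_le` — the smoothing estimate.

Proof road, `W = ‖Δ²u‖₂²`: (i) `(½W)' ≤ ν⁻¹ (G₃ + C ((M² + Y₁) W + (Λ₁² + Y₁) Z₁)) = α + β · ½W`
(flux bound, the inertial bound, `−(ν/2)‖∇Δ²u‖₂² ≤ 0`); (ii) a time `ξ ∈ [a, a + τ]` with `W(ξ) ≤ L = C₄/τ`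
(`Torus.IsClassicalNSSolutionOn.exists_mem_Icc_integral_norm_laplacian_laplacian_sq_le_of_le`); (iii) hence
`Ψ = log(A + ½W)`, `A = α/(β+1) + 1`, has `Ψ' ≤ β + 1`, and the fencing lemma
(`image_le_of_deriv_right_le_deriv_boundary`) on `[ξ, a + τ]` gives `A + ½W(a + τ) ≤ (A + L/2) e^{(β+1)τ}`
(Grönwall in logarithmic form, exactly as in the `H³` step).
Deliberately NOT here: the `H^m` ladder for `m ≥ 5`, time derivatives, existence of solutions.

## Mathlib / tree search

Tree (reused): `Torus.IsClassicalNSSolutionOn.hasDerivWithinAt_half_integral_norm_sq_laplacian_iterate`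
(`TorusClassicalHnBalance`), `Torus.abs_integral_inner_laplacian_le_gradNormSq` (`TorusClassicalNSH2Smoothing`),
`Torus.integral_inner_laplacian_comm` (`TorusFluidGlueProofs`),
`Torus.IsClassicalNSSolutionOn.exists_mem_Icc_integral_norm_laplacian_laplacian_sq_le_of_le`
(`TorusClassicalNSSobolevFourWindow`), `Torus.gradNormSq_laplacian_convect_self_le`
(`TorusConvectionGradLaplacianNormSq`); Mathlib `image_le_of_deriv_right_le_deriv_boundary`,
`HasDerivWithinAt.log`. Searched `laplacian (laplacian (u (a + τ)))`, `H4 smoothing`,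
`laplacian_laplacian_flux`, `hasDerivWithinAt_half_integral_norm_laplacian_laplacian` for classical torus
solutions: only the time-integrated bound (`TorusClassicalNSL2H4Smoothing`) and its Chebyshev time
(`TorusClassicalNSSobolevFourWindow`); no pointwise `H⁴` estimate in the tree.

## References

* J. C. Robinson, J. L. Rodrigo, W. Sadowski, *The Three-Dimensional Navier–Stokes Equations*,
  CUP 2016, Thm 7.1 ((7.3)), Thm 7.5. [RobinsonRodrigoSadowskiCUP2016]
* P. Constantin, C. Foias, *Navier–Stokes Equations*, Univ. Chicago Press 1988, Ch. 10,
  Thm 10.6 (periodic case). [ConstantinFoiasNSE1988]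
* C. Foias, O. Manley, R. Rosa, R. Temam, *Navier–Stokes Equations and Turbulence*, CUP 2001,
  Ch. II App. A (A.55) and §7. [FoiasManleyRosaTemam2001]
-/

noncomputable section

open MeasureTheory Set Function Filter
open scoped ContDiff InnerProductSpace RealInnerProductSpace Topology NNReal

namespace Literature.Analysis.FluidPDE

open Literature.Analysis.FunctionSpaces

variable {d : Type*} [Fintype d] [DecidableEq d]

/-! ### The `H⁴` balance and its flux bound -/

/-- The force slice of a classical solution on `[a, b]`, `a < b`, is smooth (it is determined by the
momentum equation). [folklore] -/
-- adapted from the private lemma of `TorusClassicalNSH2Smoothing` / `TorusClassicalH3Balance` (not exported there)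
private theorem isSmooth_force_slice {a b ν : ℝ} {f u : ℝ → UnitAddTorus d → EuclideanSpace ℝ d}
    {p : ℝ → UnitAddTorus d → ℝ} (h : Torus.IsClassicalNSSolutionOn (Icc a b) ν f u p) (hab : a < b)
    {t : ℝ} (ht : t ∈ Icc a b) : Torus.IsSmooth (f t) := by
  have hut : Torus.IsSmooth (u t) := h.smooth_velocity.isSmooth_slice ht
  have hA : Torus.IsSmooth (Torus.timeDerivWithin (Icc a b) u t) :=
    h.smooth_velocity.isSmooth_timeDerivWithin (uniqueDiffOn_Icc hab) ht
  have hpt : Torus.IsSmooth (p t) := h.smooth_pressure.isSmooth_slice ht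
  have hfun : f t = fun x => Torus.timeDerivWithin (Icc a b) u t x +
      Torus.convect (u t) (u t) x - ν • Torus.laplacian (u t) x + Torus.gradient (p t) x := by
    funext x
    rw [h.momentum t ht x]
    abel
  rw [hfun]
  exact ((hA.add (hut.convect hut)).sub (hut.laplacian.smul ν)).add hpt.gradient

/-- **The `H⁴` balance of classical Navier–Stokes solutions on the torus** (the case `n = 2` of
`Torus.IsClassicalNSSolutionOn.hasDerivWithinAt_half_integral_norm_sq_laplacian_iterate`, spelled without
iterates): `d/dt ½ ∫ ‖ΔΔu(t)‖² = −ν ‖∇ΔΔu(t)‖₂² − ∫ ⟪(u·∇)u(t) − f(t), ΔΔΔΔu(t)⟫` within `[a, b]`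
("the inner product of the momentum equation with `A⁴u`").
[cite: FoiasManleyRosaTemam2001, Ch. II App. A (A.55) and §7] -/
theorem _root_.Literature.Analysis.FunctionSpaces.Torus.IsClassicalNSSolutionOn.hasDerivWithinAt_half_integral_norm_laplacian_laplacian_sq
    {a b ν : ℝ} {f u : ℝ → UnitAddTorus d → EuclideanSpace ℝ d} {p : ℝ → UnitAddTorus d → ℝ}
    (h : Torus.IsClassicalNSSolutionOn (Icc a b) ν f u p) (hab : a < b) {t : ℝ} (ht : t ∈ Icc a b) :
    HasDerivWithinAt (fun s => 2⁻¹ * ∫ x, ‖Torus.laplacian (Torus.laplacian (u s)) x‖ ^ 2)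
      (-ν * Torus.gradNormSq (Torus.laplacian (Torus.laplacian (u t))) -
        ∫ x, ⟪Torus.convect (u t) (u t) x - f t x,
          Torus.laplacian (Torus.laplacian (Torus.laplacian (Torus.laplacian (u t)))) x⟫) (Icc a b) t :=
  -- `Δ^[2] v = Δ (Δ v)` and `Δ^[2 * 2] v = Δ (Δ (Δ (Δ v)))` hold by `rfl`
  h.hasDerivWithinAt_half_integral_norm_sq_laplacian_iterate hab 2 ht

/-- **Flux bound of the `H⁴` balance on `T^d` (any dimension), the `H³` norm of the inertial term left
symbolic.** For `ν > 0` and a classical solution on `[a, b]`, `a < b`, at every `t ∈ [a, b]`,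
`−ν‖∇ΔΔu‖₂² − ∫ ⟪(u·∇)u − f, ΔΔΔΔu⟫ ≤ −(ν/2)‖∇ΔΔu‖₂² + ν⁻¹ (‖∇Δf‖₂² + ‖∇Δ((u·∇)u)‖₂²)`: move one
Laplacian across (`∫ ⟪g, ΔΔΔΔu⟫ = ∫ ⟪Δg, ΔΔΔu⟫`, Green's second identity) and apply Young's inequality for
pairings with a Laplacian, `|∫ ⟪Δg, Δ(ΔΔu)⟫| ≤ (ε/2)‖∇Δg‖₂² + (2ε)⁻¹‖∇ΔΔu‖₂²`
(`Torus.abs_integral_inner_laplacian_le_gradNormSq`) with `ε = 2ν⁻¹` to both pairings. On `T³` the bound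
`‖∇Δ((u·∇)u)‖₂² ≤ C ((M² + ‖Δu‖₂²) ‖ΔΔu‖₂² + (Λ² + ‖Δu‖₂²) ‖∇Δu‖₂²)`
(`FunctionSpaces/TorusConvectionGradLaplacianNormSq`) turns this into the differential inequality (7.3) of
Robinson–Rodrigo–Sadowski 2016 for `k = 4`. [cite: RobinsonRodrigoSadowskiCUP2016, Thm 7.1 (7.3)] -/
theorem _root_.Literature.Analysis.FunctionSpaces.Torus.IsClassicalNSSolutionOn.laplacian_laplacian_flux_le
    {ν : ℝ} (hν : 0 < ν) {a b : ℝ} {f u : ℝ → UnitAddTorus d → EuclideanSpace ℝ d}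
    {p : ℝ → UnitAddTorus d → ℝ} (h : Torus.IsClassicalNSSolutionOn (Icc a b) ν f u p) (hab : a < b)
    {t : ℝ} (ht : t ∈ Icc a b) :
    -ν * Torus.gradNormSq (Torus.laplacian (Torus.laplacian (u t))) -
        ∫ x, ⟪Torus.convect (u t) (u t) x - f t x,
          Torus.laplacian (Torus.laplacian (Torus.laplacian (Torus.laplacian (u t)))) x⟫ ≤
      -(ν / 2) * Torus.gradNormSq (Torus.laplacian (Torus.laplacian (u t))) +
        ν⁻¹ * (Torus.gradNormSq (Torus.laplacian (f t)) +
          Torus.gradNormSq (Torus.laplacian (Torus.convect (u t) (u t)))) := by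
  have hut : Torus.IsSmooth (u t) := h.smooth_velocity.isSmooth_slice ht
  have hft : Torus.IsSmooth (f t) := isSmooth_force_slice h hab ht
  have hB : Torus.IsSmooth (Torus.convect (u t) (u t)) := hut.convect hut
  have hΔΔ : Torus.IsSmooth (Torus.laplacian (Torus.laplacian (u t))) := hut.laplacian.laplacian
  have hΔΔΔ : Torus.IsSmooth (Torus.laplacian (Torus.laplacian (Torus.laplacian (u t)))) := hΔΔ.laplacian
  have hΔ4 : Torus.IsSmooth (Torus.laplacian (Torus.laplacian (Torus.laplacian (Torus.laplacian (u t))))) :=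
    hΔΔΔ.laplacian
  have iC : Integrable (fun x => ⟪Torus.convect (u t) (u t) x,
      Torus.laplacian (Torus.laplacian (Torus.laplacian (Torus.laplacian (u t)))) x⟫) volume :=
    (hB.inner hΔ4).integrable
  have iF : Integrable (fun x => ⟪f t x,
      Torus.laplacian (Torus.laplacian (Torus.laplacian (Torus.laplacian (u t)))) x⟫) volume :=
    (hft.inner hΔ4).integrable
  have hsplit : ∫ x, ⟪Torus.convect (u t) (u t) x - f t x,
        Torus.laplacian (Torus.laplacian (Torus.laplacian (Torus.laplacian (u t)))) x⟫ =
      (∫ x, ⟪Torus.laplacian (Torus.convect (u t) (u t)) x,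
          Torus.laplacian (Torus.laplacian (Torus.laplacian (u t))) x⟫) -
        ∫ x, ⟪Torus.laplacian (f t) x, Torus.laplacian (Torus.laplacian (Torus.laplacian (u t))) x⟫ := by
    simp_rw [inner_sub_left]
    rw [integral_sub iC iF, Torus.integral_inner_laplacian_comm hB hΔΔΔ,
      Torus.integral_inner_laplacian_comm hft hΔΔΔ]
  rw [hsplit]
  have hε : 0 < 2 * ν⁻¹ := by positivity
  have h1 := Torus.abs_integral_inner_laplacian_le_gradNormSq hB.laplacian hΔΔ hε
  have h2 := Torus.abs_integral_inner_laplacian_le_gradNormSq hft.laplacian hΔΔ hε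
  have hc1 : 2 * ν⁻¹ / 2 = ν⁻¹ := by ring
  have hc2 : (2 * (2 * ν⁻¹))⁻¹ = ν / 4 := by
    rw [mul_inv, mul_inv, inv_inv]; ring
  rw [hc1, hc2] at h1 h2
  have h1' := (neg_le_abs _).trans h1
  have h2' := (le_abs_self _).trans h2
  rw [mul_add]
  linarith [h1', h2']

/-! ### The smoothing estimate -/

/-- **Quantitative `H⁴` smoothing of classical Navier–Stokes solutions on `T³` under `H³` and `W^{1,∞}`
bounds** (Robinson–Rodrigo–Sadowski 2016, Thm 7.1 with Thm 7.5, `k = 4`; Constantin–Foias 1988, Thm 10.6,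
periodic case): on `T^d` with `card d = 3`, for `ν > 0`, levels `E₁, Y₁, Z₁` (of `‖∇u‖₂²`, `‖Δu‖₂²`,
`‖∇Δu‖₂²`), force levels `G₂, G₃` (of `‖Δf‖₂²`, `‖∇Δf‖₂²`), sup levels `M, Λ₁` (of `‖u‖`, `‖∂ₖu‖`) and a time
lapse `τ > 0` there is a constant `C` such that for EVERY classical solution `(u, p)` of the Navier–Stokes
system with force `f` on `[a, a + τ] × T^d` whose velocity slices have zero mean and obey these bounds on
`[a, a + τ]`, one has `∫ ‖ΔΔu(a + τ)‖² ≤ C` — uniformly in `a`, in the solution and in `‖ΔΔu(a)‖₂`. Proof: a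
time `ξ ∈ [a, a + τ]` with `‖ΔΔu(ξ)‖₂² ≤ L` (Chebyshev on the time-integrated `H⁴` bound,
`exists_mem_Icc_integral_norm_laplacian_laplacian_sq_le_of_le`), then the fencing lemma for
`log(A + ½‖ΔΔu‖₂²)`, whose derivative is bounded by the constant `β + 1` because that of `½‖ΔΔu‖₂²` is
`≤ α + β · ½‖ΔΔu‖₂²` (`laplacian_laplacian_flux_le` and `Torus.gradNormSq_laplacian_convect_self_le`, which is
affine in `‖ΔΔu‖₂²` given the sup levels). [cite: RobinsonRodrigoSadowskiCUP2016, Thm 7.1 and Thm 7.5] -/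
theorem _root_.Literature.Analysis.FunctionSpaces.Torus.IsClassicalNSSolutionOn.integral_norm_laplacian_laplacian_sq_le_of_le
    (hd : Fintype.card d = 3) {ν : ℝ} (hν : 0 < ν) (E₁ Y₁ Z₁ G₂ G₃ M Λ₁ : ℝ) {τ : ℝ} (hτ : 0 < τ) :
    ∃ C : ℝ, ∀ {a : ℝ} {f u : ℝ → UnitAddTorus d → EuclideanSpace ℝ d} {p : ℝ → UnitAddTorus d → ℝ},
      Torus.IsClassicalNSSolutionOn (Icc a (a + τ)) ν f u p →
      (∀ t ∈ Icc a (a + τ), Torus.HasZeroMean (u t)) →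
      (∀ t ∈ Icc a (a + τ), Torus.gradNormSq (u t) ≤ E₁) →
      (∀ t ∈ Icc a (a + τ), ∫ x, ‖Torus.laplacian (u t) x‖ ^ 2 ≤ Y₁) →
      (∀ t ∈ Icc a (a + τ), Torus.gradNormSq (Torus.laplacian (u t)) ≤ Z₁) →
      (∀ t ∈ Icc a (a + τ), ∫ x, ‖Torus.laplacian (f t) x‖ ^ 2 ≤ G₂) →
      (∀ t ∈ Icc a (a + τ), Torus.gradNormSq (Torus.laplacian (f t)) ≤ G₃) →
      (∀ t ∈ Icc a (a + τ), ∀ x, ‖u t x‖ ≤ M) →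
      (∀ i, ∀ t ∈ Icc a (a + τ), ∀ x, ‖Torus.partialDeriv i (u t) x‖ ≤ Λ₁) →
        ∫ x, ‖Torus.laplacian (Torus.laplacian (u (a + τ))) x‖ ^ 2 ≤ C := by
  obtain ⟨C₄, hC₄⟩ :=
    Torus.IsClassicalNSSolutionOn.exists_mem_Icc_integral_norm_laplacian_laplacian_sq_le_of_le
      (d := d) hd hν E₁ Y₁ Z₁ G₂ hτ
  obtain ⟨C₅, hC₅0, hC₅⟩ := Torus.gradNormSq_laplacian_convect_self_le (d := d) hd
  -- the constants (all depend on `d, ν, E₁, Y₁, Z₁, G₂, G₃, M, Λ₁, τ` only)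
  set Y₁' : ℝ := max Y₁ 0
  set Z₁' : ℝ := max Z₁ 0
  set G₃' : ℝ := max G₃ 0
  set L : ℝ := max C₄ 0
  have hY₁'0 : 0 ≤ Y₁' := le_max_right _ _
  have hZ₁'0 : 0 ≤ Z₁' := le_max_right _ _
  have hG₃'0 : 0 ≤ G₃' := le_max_right _ _
  have hL0 : 0 ≤ L := le_max_right _ _
  set α : ℝ := ν⁻¹ * (G₃' + C₅ * ((Λ₁ ^ 2 + Y₁') * Z₁')) with hα
  have hα0 : 0 ≤ α := by positivity
  set β : ℝ := 2 * ν⁻¹ * (C₅ * (M ^ 2 + Y₁')) with hβ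
  have hβ0 : 0 ≤ β := by positivity
  refine ⟨(2 * (α / (β + 1) + 1) + L) * Real.exp ((β + 1) * τ),
    fun {a f u p} h h0 hE hY hZ hG₂ hG₃ hM hΛ => ?_⟩
  -- Step 1: a time `ξ ∈ [a, a + τ]` with `‖ΔΔu(ξ)‖₂² ≤ L` (Chebyshev on the `L²_t H⁴` bound)
  obtain ⟨ξ, hξab, hWξ'⟩ := hC₄ h h0 hE hY hZ hG₂
  set b : ℝ := a + τ with hb
  have hab : a < b := by rw [hb]; linarith
  -- notation for the quantities along the solution
  set Y : ℝ → ℝ := fun s => ∫ x, ‖Torus.laplacian (u s) x‖ ^ 2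
  set Z : ℝ → ℝ := fun s => Torus.gradNormSq (Torus.laplacian (u s))
  set W : ℝ → ℝ := fun s => ∫ x, ‖Torus.laplacian (Torus.laplacian (u s)) x‖ ^ 2
  set V : ℝ → ℝ := fun s => Torus.gradNormSq (Torus.laplacian (Torus.laplacian (u s)))
  set Wh' : ℝ → ℝ := fun s => -ν * V s -
    ∫ x, ⟪Torus.convect (u s) (u s) x - f s x,
      Torus.laplacian (Torus.laplacian (Torus.laplacian (Torus.laplacian (u s)))) x⟫
  have hY0 : ∀ s, 0 ≤ Y s := fun s => integral_nonneg fun x => sq_nonneg _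
  have hZ0 : ∀ s, 0 ≤ Z s := fun s => Torus.gradNormSq_nonneg _
  have hW0 : ∀ s, 0 ≤ W s := fun s => integral_nonneg fun x => sq_nonneg _
  have hV0 : ∀ s, 0 ≤ V s := fun s => Torus.gradNormSq_nonneg _
  have hY' : ∀ s ∈ Icc a b, Y s ≤ Y₁' := fun s hs => (hY s hs).trans (le_max_left _ _)
  have hZ' : ∀ s ∈ Icc a b, Z s ≤ Z₁' := fun s hs => (hZ s hs).trans (le_max_left _ _)
  have hG₃'' : ∀ s ∈ Icc a b, Torus.gradNormSq (Torus.laplacian (f s)) ≤ G₃' := fun s hs =>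
    (hG₃ s hs).trans (le_max_left _ _)
  have hWξ : W ξ ≤ L := hWξ'.trans (le_max_left _ _)
  -- the `H⁴` balance and its flux bound `(½W)' ≤ α + β · ½W`
  have hdW : ∀ s ∈ Icc a b, HasDerivWithinAt (fun r => 2⁻¹ * W r) (Wh' s) (Icc a b) s := fun s hs =>
    h.hasDerivWithinAt_half_integral_norm_laplacian_laplacian_sq hab hs
  have hWh'le : ∀ s ∈ Icc a b, Wh' s ≤ α + β * (2⁻¹ * W s) := by
    intro s hs
    have hus : Torus.IsSmooth (u s) := h.smooth_velocity.isSmooth_slice hs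
    have h1 := h.laplacian_laplacian_flux_le hν hab hs
    have h2 := hC₅ (u s) hus (hM s hs) (fun k x => hΛ k s hs x)
    have h3 : (M ^ 2 + Y s) * W s ≤ (M ^ 2 + Y₁') * W s :=
      mul_le_mul_of_nonneg_right (add_le_add le_rfl (hY' s hs)) (hW0 s)
    have h4 : (Λ₁ ^ 2 + Y s) * Z s ≤ (Λ₁ ^ 2 + Y₁') * Z₁' :=
      mul_le_mul (add_le_add le_rfl (hY' s hs)) (hZ' s hs) (hZ0 s) (by positivity)
    have h5 : C₅ * ((M ^ 2 + Y s) * W s + (Λ₁ ^ 2 + Y s) * Z s) ≤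
        C₅ * ((M ^ 2 + Y₁') * W s + (Λ₁ ^ 2 + Y₁') * Z₁') :=
      mul_le_mul_of_nonneg_left (add_le_add h3 h4) hC₅0
    have h6 : ν⁻¹ * (Torus.gradNormSq (Torus.laplacian (f s)) +
        Torus.gradNormSq (Torus.laplacian (Torus.convect (u s) (u s)))) ≤
        ν⁻¹ * (G₃' + C₅ * ((M ^ 2 + Y₁') * W s + (Λ₁ ^ 2 + Y₁') * Z₁')) :=
      mul_le_mul_of_nonneg_left (add_le_add (hG₃'' s hs) (h2.trans h5)) (inv_pos.2 hν).le
    have h7 : ν⁻¹ * (G₃' + C₅ * ((M ^ 2 + Y₁') * W s + (Λ₁ ^ 2 + Y₁') * Z₁')) = α + β * (2⁻¹ * W s) := by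
      rw [hα, hβ]; ring
    have h8 : 0 ≤ ν / 2 * V s := mul_nonneg (by positivity) (hV0 s)
    calc Wh' s ≤ -(ν / 2) * V s + ν⁻¹ * (Torus.gradNormSq (Torus.laplacian (f s)) +
          Torus.gradNormSq (Torus.laplacian (Torus.convect (u s) (u s)))) := h1
      _ ≤ ν⁻¹ * (G₃' + C₅ * ((M ^ 2 + Y₁') * W s + (Λ₁ ^ 2 + Y₁') * Z₁')) := by linarith [h6, h8]
      _ = α + β * (2⁻¹ * W s) := h7
  -- Step 2: the Lyapunov function `Ψ = log (A + ½W)` has `Ψ' ≤ β'` (`β' = β + 1`, `A = α/β' + 1`)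
  set β' : ℝ := β + 1 with hβ'
  have hβ'0 : 0 < β' := by rw [hβ']; linarith
  set A : ℝ := α / β' + 1 with hA
  have hA0 : 0 < A := by rw [hA]; positivity
  have hβ'A : β' * A = α + β' := by rw [hA]; field_simp
  set Ψ : ℝ → ℝ := fun s => Real.log (A + 2⁻¹ * W s)
  set Ψ' : ℝ → ℝ := fun s => Wh' s / (A + 2⁻¹ * W s)
  have hdΨ : ∀ s ∈ Icc a b, HasDerivWithinAt Ψ (Ψ' s) (Icc a b) s := by
    intro s hs
    have hpos : A + 2⁻¹ * W s ≠ 0 := by have := hW0 s; positivity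
    have hlog := ((hasDerivWithinAt_const s (Icc a b) A).add (hdW s hs)).log hpos
    rw [zero_add] at hlog
    exact hlog
  have hΨ'le : ∀ s ∈ Icc a b, Ψ' s ≤ β' := by
    intro s hs
    have hWs := hW0 s
    have hden : 0 < A + 2⁻¹ * W s := by positivity
    have h1 := hWh'le s hs
    have h2 : β * (2⁻¹ * W s) ≤ β' * (2⁻¹ * W s) :=
      mul_le_mul_of_nonneg_right (by rw [hβ']; linarith) (by positivity)
    change Wh' s / (A + 2⁻¹ * W s) ≤ β'
    rw [div_le_iff₀ hden]
    linarith [h1, h2, hβ'A]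
  -- Step 3: fencing on `[ξ, b]`
  have hΨc : ContinuousOn Ψ (Icc ξ b) := fun s hs =>
    ((hdΨ s ⟨hξab.1.trans hs.1, hs.2⟩).continuousWithinAt).mono (Icc_subset_Icc hξab.1 le_rfl)
  have hΨr : ∀ s ∈ Ico ξ b, HasDerivWithinAt Ψ (Ψ' s) (Ici s) s := fun s hs =>
    ((hdΨ s ⟨hξab.1.trans hs.1, hs.2.le⟩).mono (Icc_subset_Icc (hξab.1.trans hs.1) le_rfl)).mono_of_mem_nhdsWithin
      (Icc_mem_nhdsGE hs.2)
  have hfence := image_le_of_deriv_right_le_deriv_boundary hΨc hΨr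
    (B := fun s => Ψ ξ + β' * (s - ξ)) (B' := fun _ => β') (by simp)
    (by fun_prop)
    (fun s _ => by
      have h1 : HasDerivWithinAt (fun r => Ψ ξ + β' * (r - ξ)) (0 + β' * (1 - 0)) (Ici s) s :=
        (hasDerivWithinAt_const _ _ _).add (((hasDerivWithinAt_id _ _).sub
          (hasDerivWithinAt_const _ _ _)).const_mul β')
      simpa using h1)
    (fun s hs => hΨ'le s ⟨hξab.1.trans hs.1, hs.2.le⟩) (right_mem_Icc.2 hξab.2)
  have hfence' : Ψ b ≤ Ψ ξ + β' * (b - ξ) := hfence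
  -- Step 4: unwind `log (A + ½W b) ≤ log (A + ½W ξ) + β' (b - ξ) ≤ log (A + L/2) + β' τ`
  have hΨξ : Ψ ξ ≤ Real.log (A + L / 2) := by
    change Real.log (A + 2⁻¹ * W ξ) ≤ Real.log (A + L / 2)
    exact Real.log_le_log (by have := hW0 ξ; positivity) (by linarith [hWξ])
  have hbξ : β' * (b - ξ) ≤ β' * τ := by
    refine mul_le_mul_of_nonneg_left ?_ hβ'0.le
    rw [hb]; linarith [hξab.1]
  have hlogb : Real.log (A + 2⁻¹ * W b) ≤ Real.log (A + L / 2) + β' * τ := by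
    have h1 : Real.log (A + 2⁻¹ * W b) = Ψ b := rfl
    linarith [hfence', hΨξ, hbξ, h1]
  have hAWb : 0 < A + 2⁻¹ * W b := by have := hW0 b; positivity
  have hexp : A + 2⁻¹ * W b ≤ (A + L / 2) * Real.exp (β' * τ) := by
    have h2 := Real.exp_le_exp.2 hlogb
    rwa [Real.exp_log hAWb, Real.exp_add, Real.exp_log (by positivity)] at h2
  calc ∫ x, ‖Torus.laplacian (Torus.laplacian (u b)) x‖ ^ 2 = W b := rfl
    _ ≤ 2 * (A + 2⁻¹ * W b) := by linarith [hA0]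
    _ ≤ 2 * ((A + L / 2) * Real.exp (β' * τ)) := by linarith [hexp]
    _ = (2 * (α / (β + 1) + 1) + L) * Real.exp ((β + 1) * τ) := by rw [hA, hβ']; ring

end Literature.Analysis.FluidPDE

end
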